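/-
Copyright (c) 2026 the pub-hodgecm-mathlib formalisation cell (harness21).  Prover seat hodgecm-mathlib-K2E3-p12 (g4), Track B «K2-LIT» ∕ h413
(`stmt-HodgeConjecture-24833`), line `K2_E3_EllipticInputs`, unit U12-d, §L (Φ′-c, generic frame): TRANSPORT OF `J(𝒩)`-DISTRIBUTIONS AND OF THEIR FOURIER
REGULARITY ALONG `Φ : 𝔲(σ, J₀) ≃ 𝔤𝔩₂(F)`.  2026-09-04.
-/
import Summits.HodgeConjecture.HodgeConjecture.Theorems.K2E3U11LieTransportEquivariance   -- ★ p857199 (this seat): `Φ ∘ Ad(u_g) = Ad(g) ∘ Φ` for `det g ∈ Nm`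
import Summits.HodgeConjecture.HodgeConjecture.Theorems.K2E3U11LieTransportFourier        -- ★ K2E5-p17 (g3): `Φ_* μ` Haar, `lieFourier` read on `𝔤𝔩₂(F)`
import Literature.NumberTheory.Rogawski1990.LocalTransferFundamentalLemma                   -- ★ `IsLocSmooth`
import Mathlib.MeasureTheory.Function.LocallyIntegrable
import HarnessLib

/-!
# K2_E3 road (h413), §L — (Φ′-c, generic frame): `J(𝒩)(𝔲(σ,J₀))` and its Fourier regularity are read on `𝔤𝔩₂(F)` through `Φ`

Cell `pub/hodgecm-mathlib` (D-0151), Track B, seat K2E3-p12 (g4), §L line lead (MEMO v3 76bc1f2b, road «U-iso-T»).  `--supports stmt-HodgeConjecture-24833 --as helper`;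
count-neutral plumbing toward the hosted socket (L-B_U)′ `sig_K2E3UNilpotentFourierRegular` (U12 ED. 7 :373) at `N = 2`, ISOTROPIC place form.

Frame: the abstract quadratic frame of ★ `K2E3U11LieTransport` (`σ`, `ι : F →+* E`, `λ`, coordinates `ρ`, `λ² = ι d`) and the bi-continuous additive transport
`Φ : 𝔲(σ, J₀) ≃+ 𝔤𝔩₂(F)`, `J₀ = antidiag(1,1)`.  For a functional `T` on `C_c^∞(𝔲)` write `T′ f′ := T (f′ ∘ Φ)` (no definitions: every statement is about `T (fun X => f′ (Φ X))`).

* §1 `isLocSmooth_comp_homeomorph'`, `tsupport_comp_homeomorph` — `C_c^∞` and `tsupport` through a homeomorphism.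
* §2 **the four `J(𝒩)` clauses transport**: `isLocSmooth_comp_lieTransport(_symm)`; **`transport_pointSupport`** (clause (iv): `tsupport f′ ∩ 𝒩 = ∅ ⇒ T′ f′ = 0`, ★
  `lieTransport_isNilpotent_iff`); **`transport_conj_invariant`** (clause (iii): `T′` is `Ad(g)`-invariant for every `g ∈ GL₂(F)` with `ι(det g) ∈ Nm(Eˣ)`, ★
  `exists_unitary_lieTransport_conj_eq`); **`transport_twist`** (`T′(g ∘ S_c) = T′ g` for the central twists `S_c Z = Z + (c · tr Z)·1`, `1 + 2c ≠ 0`, from clauses (i)+(iv) alone: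
  `g ∘ S_c − g` vanishes near the traceless cone).
* §3 **`transport_lieFourier`** — `T(𝓕_𝔲 f) = T′(𝓕_F (f ∘ Φ⁻¹))` with `𝓕_F h (Y′) = ∫ ψ(ι(tr(Y′X′))) h(X′) dΦ_*μ(X′)` (★ K2E5-p17 `lieFourier_eq_integral_map` + `transport_twist` at
  `c = (d−1)∕2`, `1 + 2c = d ≠ 0`).
* §4 **`nilpotentFourierRegular_of_transport`** — THE REDUCTION: if `T′ ∘ 𝓕_F` is represented by a `Φ_*μ`-locally-integrable `Fn′`, locally constant on `{disc ≠ 0}` and with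
  `ω_F(disc X′)·‖Fn′ X′‖` locally bounded, then `T ∘ 𝓕_𝔲` is represented by `Fn := Fn′ ∘ Φ` with the same three properties for any weight `ω_E` with `ω_E ∘ ι = ω_F`
  (★ `lieTransport_discr`: `disc X = ι(disc ΦX)`).  This is the (L-B_U)′-conclusion shape VERBATIM up to currency; the CM instantiation (`F = L⁺_v`, `ι = toPlace v w`,
  congruence `H_w ~ J₀` at an isotropic place, `ω_E = √√normAbs_{L_w}`, `ω_F = √normAbs_{L⁺_v}`) is the next file.

HONEST LABEL: HC_CM is proved only modulo the 7 printed citations (2 remaining named inputs: hLiu418 = stmt-HodgeConjecture-24832, h413 = stmt-HodgeConjecture-24833)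
until rung 0 closes; count-neutral plumbing.

References: [HarishChandra1999AdmissibleDistributions] Harish-Chandra (DeBacker–Sally), *Admissible Invariant Distributions on Reductive p-adic Groups* (1999), §3 p. 8,
Thm. 4.4 p. 11, Thm. 7.5 p. 51; [PlatonovRapinchuk1994] Platonov–Rapinchuk, *Algebraic Groups and Number Theory* (1994), §2.3; [Folland1995] Folland, *A Course in Abstract
Harmonic Analysis* (1995), §2.2 Thm. 2.20; [Rogawski1990] Rogawski, *Automorphic Representations of Unitary Groups in Three Variables* (1990), §1.6.
-/

set_option autoImplicit false
set_option linter.dupNamespace false   -- `Summit.HodgeConjecture.HodgeConjecture.…` (D-0017 nested layout; lakefile exemption for Summits)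

noncomputable section

open MeasureTheory Measure Filter Topology
open scoped Matrix MatrixGroups
open Literature.NumberTheory.Rogawski1990 Literature.NumberTheory.Automorphic
open Summit.HodgeConjecture.HodgeConjecture.Cruxes.H413.K2E3LieUnitary (lieOfForm mem_lieOfForm_iff conj_mem_lieOfForm lieFourier lieFourier_apply)
open Summit.HodgeConjecture.HodgeConjecture.Cruxes.H413.K2E3U11LieTransport
open Summit.HodgeConjecture.HodgeConjecture.Cruxes.H413.K2E3U11LieTransportEquivariance (exists_unitary_lieTransport_conj_eq)
open Summit.HodgeConjecture.HodgeConjecture.Cruxes.H413.K2E3U11LieTransportFourier (integral_comp_lieTransport lieFourier_eq_integral_map)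

namespace Summit.HodgeConjecture.HodgeConjecture.Cruxes.H413.K2E3U11NilpotentInvariantTransport

/-! ## §1  `C_c^∞` through a homeomorphism -/

section Homeomorph

variable {X Y : Type*} [TopologicalSpace X] [TopologicalSpace Y]

/-- `f ∘ e ∈ C_c^∞` for `f ∈ C_c^∞` and a homeomorphism `e`. [cite: Rogawski1990, §1.6 p. 6] -/
theorem isLocSmooth_comp_homeomorph' (e : X ≃ₜ Y) {f : Y → ℂ} (hf : IsLocSmooth f) : IsLocSmooth (fun x => f (e x)) :=
  ⟨hf.1.comp_continuous e.continuous, hf.2.comp_homeomorph e⟩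

/-- `tsupport (f ∘ e) = e⁻¹(tsupport f)` for a homeomorphism `e`. [folklore] -/
theorem tsupport_comp_homeomorph (e : X ≃ₜ Y) (f : Y → ℂ) : tsupport (fun x => f (e x)) = e ⁻¹' tsupport f := by
  rw [tsupport, tsupport, e.preimage_closure]
  congr 1

/-- A function that is constant `0` on a neighbourhood of `x` has `x ∉ tsupport`. [folklore] -/
theorem notMem_tsupport_of_eventually {f : X → ℂ} {x : X} (h : ∀ᶠ y in 𝓝 x, f y = 0) : x ∉ tsupport f :=
  notMem_tsupport_iff_eventuallyEq.2 h

end Homeomorph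

/-! ## §2  The four `J(𝒩)` clauses through `Φ` -/

section Transfer

variable {F E : Type*} [Field F] [Field E] [TopologicalSpace F] [TopologicalSpace E] [IsTopologicalRing F] [IsTopologicalRing E]
  (σ : E →+* E) (ι : F →+* E) (lam : E) (ρ : E → F × F)
  (hρ1 : ∀ z, ι (ρ z).1 + lam * ι (ρ z).2 = z) (hσι : ∀ r, σ (ι r) = ι r) (hσl : σ lam = -lam) (h2 : (2 : E) ≠ 0) (d : F) (hd : lam * lam = ι d)
  (hl0 : lam ≠ 0)
  (Φ : ↥(lieOfForm σ !![(0 : E), 1; 1, 0]) ≃+ Matrix (Fin 2) (Fin 2) F) (hΦc : Continuous Φ) (hΦs : Continuous Φ.symm)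
  (hΦ : ∀ X : ↥(lieOfForm σ !![(0 : E), 1; 1, 0]),
    Φ X = !![(ρ (X.1 0 0)).1 + (ρ (X.1 0 0)).2, d * (ρ (X.1 0 1)).2; (ρ (X.1 1 0)).2, (ρ (X.1 0 0)).2 - (ρ (X.1 0 0)).1])
  (T : (↥(lieOfForm σ !![(0 : E), 1; 1, 0]) → ℂ) → ℂ)

omit [IsTopologicalRing F] [IsTopologicalRing E] in
include hΦc hΦs in
/-- **`f′ ∘ Φ ∈ C_c^∞(𝔲)` for `f′ ∈ C_c^∞(𝔤𝔩₂(F))`.** [cite: Rogawski1990, §1.6 p. 6] [cite: PlatonovRapinchuk1994, §2.3] -/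
theorem isLocSmooth_comp_lieTransport {f' : Matrix (Fin 2) (Fin 2) F → ℂ} (hf' : IsLocSmooth f') : IsLocSmooth (fun X => f' (Φ X)) :=
  isLocSmooth_comp_homeomorph' ({ toEquiv := Φ.toEquiv, continuous_toFun := hΦc, continuous_invFun := hΦs } : ↥(lieOfForm σ !![(0 : E), 1; 1, 0]) ≃ₜ Matrix (Fin 2) (Fin 2) F) hf'

omit [IsTopologicalRing F] [IsTopologicalRing E] in
include hΦc hΦs in
/-- **`f ∘ Φ⁻¹ ∈ C_c^∞(𝔤𝔩₂(F))` for `f ∈ C_c^∞(𝔲)`.** [cite: Rogawski1990, §1.6 p. 6] [cite: PlatonovRapinchuk1994, §2.3] -/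
theorem isLocSmooth_comp_lieTransport_symm {f : ↥(lieOfForm σ !![(0 : E), 1; 1, 0]) → ℂ} (hf : IsLocSmooth f) : IsLocSmooth (fun X' => f (Φ.symm X')) :=
  isLocSmooth_comp_homeomorph' ({ toEquiv := Φ.toEquiv, continuous_toFun := hΦc, continuous_invFun := hΦs } : ↥(lieOfForm σ !![(0 : E), 1; 1, 0]) ≃ₜ Matrix (Fin 2) (Fin 2) F).symm hf

omit [IsTopologicalRing F] [IsTopologicalRing E] in
include hρ1 hσι hσl h2 hd hl0 hΦc hΦs hΦ in
/-- **CLAUSE (iv) TRANSPORTS**: if `T` kills every `f ∈ C_c^∞(𝔲)` whose closed support avoids the nilpotent cone, then `T′ f′ := T(f′ ∘ Φ)` kills every `f′ ∈ C_c^∞(𝔤𝔩₂(F))` whose closed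
support avoids the nilpotent cone of `𝔤𝔩₂(F)` — `Φ` carries cone to cone (★ `lieTransport_isNilpotent_iff`) and `tsupport(f′∘Φ) = Φ⁻¹(tsupport f′)`.
[cite: HarishChandra1999AdmissibleDistributions, §3 p. 8] [cite: PlatonovRapinchuk1994, §2.3] -/
theorem transport_pointSupport
    (hT4 : ∀ f : ↥(lieOfForm σ !![(0 : E), 1; 1, 0]) → ℂ, IsLocSmooth f → (∀ X ∈ tsupport f, ¬ IsNilpotent X.1) → T f = 0)
    (f' : Matrix (Fin 2) (Fin 2) F → ℂ) (hf' : IsLocSmooth f') (hN : ∀ X' ∈ tsupport f', ¬ IsNilpotent X') : T (fun X => f' (Φ X)) = 0 := by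
  refine hT4 _ (isLocSmooth_comp_lieTransport σ Φ hΦc hΦs hf') fun X hX hXn => ?_
  have hX' : Φ X ∈ tsupport f' := by
    have h := tsupport_comp_homeomorph ({ toEquiv := Φ.toEquiv, continuous_toFun := hΦc, continuous_invFun := hΦs } : ↥(lieOfForm σ !![(0 : E), 1; 1, 0]) ≃ₜ Matrix (Fin 2) (Fin 2) F) f'
    rw [show (fun x => f' (({ toEquiv := Φ.toEquiv, continuous_toFun := hΦc, continuous_invFun := hΦs } : ↥(lieOfForm σ !![(0 : E), 1; 1, 0]) ≃ₜ Matrix (Fin 2) (Fin 2) F) x)) = fun X => f' (Φ X) from rfl] at h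
    rw [h] at hX
    exact hX
  exact hN _ hX' ((lieTransport_isNilpotent_iff σ ι lam ρ hρ1 hσι hσl h2 d hd Φ hΦ hl0 X).1 hXn)

omit [TopologicalSpace F] [IsTopologicalRing F] [IsTopologicalRing E] in
include hρ1 hσι hσl h2 hd hl0 hΦ in
/-- **CLAUSE (iii) TRANSPORTS TO `G⁺ = det⁻¹(Nm Eˣ)`**: if `T` is `Ad(U(σ, J₀))`-invariant then `T′ f′ := T(f′ ∘ Φ)` is `Ad(g)`-invariant for every `g ∈ GL₂(F)` whose determinant is a
norm, `ι(det g) · e·σ(e) = 1` — because such an `Ad(g) ∘ Φ = Φ ∘ Ad(u)` for a unitary `u` (★ `exists_unitary_lieTransport_conj_eq`).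
[cite: PlatonovRapinchuk1994, §2.3] [cite: HarishChandra1999AdmissibleDistributions, Thm. 4.4 p. 11] -/
theorem transport_conj_invariant
    (hT3 : ∀ (x : ↥(unitaryGroupOfForm σ !![(0 : E), 1; 1, 0])) (f : ↥(lieOfForm σ !![(0 : E), 1; 1, 0]) → ℂ), IsLocSmooth f →
      T (fun X => f ⟨((x : GL (Fin 2) E) : Matrix (Fin 2) (Fin 2) E) * X.1 * (((x : GL (Fin 2) E)⁻¹ : GL (Fin 2) E) : Matrix (Fin 2) (Fin 2) E),
        conj_mem_lieOfForm x.2 X.2⟩) = T f)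
    (g : GL (Fin 2) F) (e : E) (he : ι ((g : Matrix (Fin 2) (Fin 2) F).det) * (e * σ e) = 1)
    (f' : Matrix (Fin 2) (Fin 2) F → ℂ) (hf' : IsLocSmooth (fun X : ↥(lieOfForm σ !![(0 : E), 1; 1, 0]) => f' (Φ X))) :
    T (fun X => f' ((g : Matrix (Fin 2) (Fin 2) F) * Φ X * ((g⁻¹ : GL (Fin 2) F) : Matrix (Fin 2) (Fin 2) F))) = T (fun X => f' (Φ X)) := by
  obtain ⟨u, hu, huΦ⟩ := exists_unitary_lieTransport_conj_eq σ ι lam ρ hρ1 hσι hσl h2 d hd hl0 Φ hΦ g e he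
  have key := hT3 ⟨u, hu⟩ (fun X => f' (Φ X)) hf'
  refine Eq.trans ?_ key
  congr 1
  funext X
  simp only
  rw [huΦ X ⟨(u : Matrix (Fin 2) (Fin 2) E) * X.1 * ((u⁻¹ : GL (Fin 2) E) : Matrix (Fin 2) (Fin 2) E), conj_mem_lieOfForm hu X.2⟩ rfl]

include hΦc hΦs in
/-- **CENTRAL TWISTS ARE INVISIBLE TO `J(𝒩)`**: for `S_c Z = Z + (c · tr Z)·1` with `1 + 2c ≠ 0` and `g ∈ C_c^∞(𝔤𝔩₂(F))`, `T(g ∘ S_c ∘ Φ) = T(g ∘ Φ)` whenever `T` is additive on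
`C_c^∞(𝔲)` and kills functions supported off the nilpotent cone: `g ∘ S_c − g` vanishes on a neighbourhood of every traceless point (where `S_c = id` and `g` is locally
constant), in particular near `Φ(𝒩_𝔲) ⊆ {tr = 0}`. [cite: HarishChandra1999AdmissibleDistributions, §3 p. 8, Thm. 4.4 p. 11] -/
theorem transport_twist [T2Space E]
    (hT1 : ∀ f₁ f₂ : ↥(lieOfForm σ !![(0 : E), 1; 1, 0]) → ℂ, IsLocSmooth f₁ → IsLocSmooth f₂ → T (f₁ + f₂) = T f₁ + T f₂)
    (hT4 : ∀ f : ↥(lieOfForm σ !![(0 : E), 1; 1, 0]) → ℂ, IsLocSmooth f → (∀ X ∈ tsupport f, ¬ IsNilpotent X.1) → T f = 0)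
    (hΦN : ∀ X : ↥(lieOfForm σ !![(0 : E), 1; 1, 0]), IsNilpotent X.1 → IsNilpotent (Φ X))
    (c : F) (hc : 1 + 2 * c ≠ 0) (g : Matrix (Fin 2) (Fin 2) F → ℂ) (hg : IsLocSmooth g) (hgΦ : IsLocSmooth (fun X : ↥(lieOfForm σ !![(0 : E), 1; 1, 0]) => g (Φ X))) :
    T (fun X => g (Φ X + (c * Matrix.trace (Φ X)) • (1 : Matrix (Fin 2) (Fin 2) F))) = T (fun X => g (Φ X)) := by
  haveI : IsTopologicalAddGroup (Matrix (Fin 2) (Fin 2) F) := inferInstanceAs (IsTopologicalAddGroup (Fin 2 → Fin 2 → F))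
  haveI : ContinuousConstSMul F (Matrix (Fin 2) (Fin 2) F) := inferInstanceAs (ContinuousConstSMul F (Fin 2 → Fin 2 → F))
  -- the twist as a homeomorphism of `𝔤𝔩₂(F)`
  have htr : Continuous fun Z : Matrix (Fin 2) (Fin 2) F => Matrix.trace Z := by
    show Continuous fun Z : Matrix (Fin 2) (Fin 2) F => ∑ i, Z i i
    exact continuous_finsetSum _ fun i _ => (continuous_apply i).comp (continuous_apply i)
  have hSc : ∀ a : F, Continuous fun Z : Matrix (Fin 2) (Fin 2) F => Z + (a * Matrix.trace Z) • (1 : Matrix (Fin 2) (Fin 2) F) := fun a =>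
    continuous_id.add ((continuous_const.mul htr).smul continuous_const)
  have htr1 : Matrix.trace (1 : Matrix (Fin 2) (Fin 2) F) = 2 := by rw [Matrix.trace_one, Fintype.card_fin]; norm_num
  have hu : (1 + 2 * c) * (1 + 2 * c)⁻¹ = 1 := mul_inv_cancel₀ hc
  have hsc1 : ∀ t : F, c * t + -(c / (1 + 2 * c)) * (t + c * t * 2) = 0 := fun t => by
    rw [div_eq_mul_inv]; linear_combination (-(c * t)) * hu
  have hsc2 : ∀ t : F, -(c / (1 + 2 * c)) * t + c * (t + -(c / (1 + 2 * c)) * t * 2) = 0 := fun t => by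
    rw [div_eq_mul_inv]; linear_combination (-(c * t)) * hu
  let S : Matrix (Fin 2) (Fin 2) F ≃ₜ Matrix (Fin 2) (Fin 2) F :=
    { toFun := fun Z => Z + (c * Matrix.trace Z) • (1 : Matrix (Fin 2) (Fin 2) F)
      invFun := fun Z => Z + ((-(c / (1 + 2 * c))) * Matrix.trace Z) • (1 : Matrix (Fin 2) (Fin 2) F)
      left_inv := fun Z => by
        simp only [Matrix.trace_add, Matrix.trace_smul, htr1, smul_eq_mul]
        rw [add_assoc, ← add_smul, hsc1, zero_smul, add_zero]
      right_inv := fun Z => by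
        simp only [Matrix.trace_add, Matrix.trace_smul, htr1, smul_eq_mul]
        rw [add_assoc, ← add_smul, hsc2, zero_smul, add_zero]
      continuous_toFun := hSc c
      continuous_invFun := hSc _ }
  have hS : ∀ Z, S Z = Z + (c * Matrix.trace Z) • (1 : Matrix (Fin 2) (Fin 2) F) := fun _ => rfl
  -- the difference `h := g ∘ S ∘ Φ − g ∘ Φ` is smooth and vanishes near the nilpotent cone
  have hgS : IsLocSmooth (fun Z => g (S Z)) := isLocSmooth_comp_homeomorph' S hg
  have hgSΦ : IsLocSmooth (fun X : ↥(lieOfForm σ !![(0 : E), 1; 1, 0]) => g (S (Φ X))) :=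
    ⟨hgS.1.comp_continuous hΦc, by
      refine HasCompactSupport.of_support_subset_isCompact ((hgS.2.isCompact).image hΦs) fun X hX => ?_
      exact ⟨Φ X, subset_tsupport _ hX, Φ.symm_apply_apply X⟩⟩
  obtain ⟨h, hh⟩ : ∃ h : ↥(lieOfForm σ !![(0 : E), 1; 1, 0]) → ℂ, ∀ X, h X = g (S (Φ X)) - g (Φ X) := ⟨_, fun _ => rfl⟩
  have hhs : IsLocSmooth h := by
    have : h = (fun X => g (S (Φ X))) + fun X => -g (Φ X) := funext fun X => by rw [hh, Pi.add_apply, sub_eq_add_neg]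
    rw [this]
    exact ⟨hgSΦ.1.add hgΦ.1.neg, hgSΦ.2.add hgΦ.2.neg⟩
  have hh0 : T h = 0 := by
    refine hT4 h hhs fun X hX hXn => ?_
    -- near a nilpotent `X`, `g ∘ S ∘ Φ = g ∘ Φ = g(ΦX)`
    have htr0 : Matrix.trace (Φ X) = 0 := by
      obtain ⟨hn, -⟩ := (isNilpotent_iff_trace_eq_zero_and_det_eq_zero (Φ X)).1 (hΦN X hXn)
      exact hn
    have hSX : S (Φ X) = Φ X := by rw [hS, htr0, mul_zero, zero_smul, add_zero]
    obtain ⟨V, hVo, hXV, hV⟩ := hg.1.exists_open (Φ X)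
    have hW : ∀ᶠ Y in 𝓝 X, h Y = 0 := by
      have h1 : ∀ᶠ Y in 𝓝 X, Φ Y ∈ V := hΦc.continuousAt.eventually (hVo.mem_nhds hXV)
      have h2 : ∀ᶠ Y in 𝓝 X, S (Φ Y) ∈ V :=
        (S.continuous.comp hΦc).continuousAt.eventually (hVo.mem_nhds (by show S (Φ X) ∈ V; rw [hSX]; exact hXV))
      filter_upwards [h1, h2] with Y hY1 hY2
      rw [hh, hV _ hY2, hV _ hY1, sub_self]
    exact notMem_tsupport_of_eventually hW hX
  have hsum : (fun X => g (Φ X + (c * Matrix.trace (Φ X)) • (1 : Matrix (Fin 2) (Fin 2) F))) = (fun X => g (Φ X)) + h :=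
    funext fun X => by rw [Pi.add_apply, hh, ← hS, add_sub_cancel]
  rw [hsum, hT1 _ _ hgΦ hhs, hh0, add_zero]

end Transfer

/-! ## §3  The Fourier transform of `𝔲` read on `𝔤𝔩₂(F)` inside `T` -/

section Fourier

variable {F E : Type*} [Field F] [Field E] [TopologicalSpace F] [TopologicalSpace E] [IsTopologicalRing F] [IsTopologicalRing E]
  (σ : E →+* E) (ι : F →+* E) (lam : E) (ρ : E → F × F)
  (hρ1 : ∀ z, ι (ρ z).1 + lam * ι (ρ z).2 = z) (hσι : ∀ r, σ (ι r) = ι r) (hσl : σ lam = -lam) (h2 : (2 : E) ≠ 0) (d : F) (hd : lam * lam = ι d)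
  (hl0 : lam ≠ 0)
  [MeasurableSpace ↥(lieOfForm σ !![(0 : E), 1; 1, 0])] [BorelSpace ↥(lieOfForm σ !![(0 : E), 1; 1, 0])]
  [MeasurableSpace (Matrix (Fin 2) (Fin 2) F)] [BorelSpace (Matrix (Fin 2) (Fin 2) F)]
  (Φ : ↥(lieOfForm σ !![(0 : E), 1; 1, 0]) ≃+ Matrix (Fin 2) (Fin 2) F) (hΦc : Continuous Φ) (hΦs : Continuous Φ.symm)
  (hΦ : ∀ X : ↥(lieOfForm σ !![(0 : E), 1; 1, 0]),
    Φ X = !![(ρ (X.1 0 0)).1 + (ρ (X.1 0 0)).2, d * (ρ (X.1 0 1)).2; (ρ (X.1 1 0)).2, (ρ (X.1 0 0)).2 - (ρ (X.1 0 0)).1])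
  (T : (↥(lieOfForm σ !![(0 : E), 1; 1, 0]) → ℂ) → ℂ)

include hρ1 hσι hσl h2 hd hl0 hΦc hΦs hΦ in
/-- **`T(𝓕_𝔲 f) = T′(𝓕_F(f ∘ Φ⁻¹))`** for `T ∈ J(𝒩)(𝔲)` (additive + clause (iv)), where `𝓕_F h (Y′) = ∫ ψ(ι(tr(Y′·X′))) h(X′) dΦ_*μ(X′)` is the `𝔤𝔩₂(F)`-Fourier transform for the
character `ψ ∘ ι` and the Haar measure `Φ_*μ`: ★ K2E5-p17 `lieFourier_eq_integral_map` says `𝓕_𝔲 f = 𝓕_F(f∘Φ⁻¹) ∘ S ∘ Φ` with the central twist `S = S_{(d−1)∕2}`, and ★ `transport_twist`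
removes `S` (`1 + 2·(d−1)∕2 = d ≠ 0`).  Hypothesis `hF`: `𝓕_F(f∘Φ⁻¹) ∈ C_c^∞` (true for `ψ` a non-trivial continuous character of a non-archimedean local `F` and Haar `μ`; supplied
by the instantiation). [cite: HarishChandra1999AdmissibleDistributions, Thm. 4.4 p. 11] [cite: Folland1995, §2.2 Thm. 2.20] -/
theorem transport_lieFourier [T2Space E]
    (hT1 : ∀ f₁ f₂ : ↥(lieOfForm σ !![(0 : E), 1; 1, 0]) → ℂ, IsLocSmooth f₁ → IsLocSmooth f₂ → T (f₁ + f₂) = T f₁ + T f₂)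
    (hT4 : ∀ f : ↥(lieOfForm σ !![(0 : E), 1; 1, 0]) → ℂ, IsLocSmooth f → (∀ X ∈ tsupport f, ¬ IsNilpotent X.1) → T f = 0)
    (ψ : E → ℂ) (μ : Measure ↥(lieOfForm σ !![(0 : E), 1; 1, 0])) (f : ↥(lieOfForm σ !![(0 : E), 1; 1, 0]) → ℂ)
    (hF : IsLocSmooth (fun Y' : Matrix (Fin 2) (Fin 2) F => ∫ X', ψ (ι (Matrix.trace (Y' * X'))) * f (Φ.symm X') ∂(μ.map Φ))) :
    T (lieFourier σ !![(0 : E), 1; 1, 0] ψ μ f) =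
      T (fun Y => (fun Y' : Matrix (Fin 2) (Fin 2) F => ∫ X', ψ (ι (Matrix.trace (Y' * X'))) * f (Φ.symm X') ∂(μ.map Φ)) (Φ Y)) := by
  have hd0 : d ≠ 0 := fun h => by rw [h, map_zero] at hd; exact mul_ne_zero hl0 hl0 hd
  have hc : (1 : F) + 2 * ((d - 1) / 2) ≠ 0 := by
    have h2F : (2 : F) ≠ 0 := fun h => h2 (by rw [← map_ofNat ι 2, h, map_zero])
    rw [mul_div_cancel₀ _ h2F, add_sub_cancel]
    exact hd0
  have hfun : lieFourier σ !![(0 : E), 1; 1, 0] ψ μ f =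
      fun Y => (fun Y' : Matrix (Fin 2) (Fin 2) F => ∫ X', ψ (ι (Matrix.trace (Y' * X'))) * f (Φ.symm X') ∂(μ.map Φ))
        (Φ Y + (((d - 1) / 2) * Matrix.trace (Φ Y)) • (1 : Matrix (Fin 2) (Fin 2) F)) :=
    funext fun Y => lieFourier_eq_integral_map σ ι lam ρ hρ1 hσι hσl h2 d hd Φ hΦc hΦs hΦ ψ μ f Y
  rw [hfun]
  exact transport_twist σ Φ hΦc hΦs T hT1 hT4 (fun X hX => (lieTransport_isNilpotent_iff σ ι lam ρ hρ1 hσι hσl h2 d hd Φ hΦ hl0 X).1 hX) _ hc _ hF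
    (isLocSmooth_comp_lieTransport σ Φ hΦc hΦs hF)

end Fourier

/-! ## §4  The reduction: Fourier regularity of `T′` on `𝔤𝔩₂(F)` gives Fourier regularity of `T` on `𝔲` -/

section Regularity

variable {F E : Type*} [Field F] [Field E] [TopologicalSpace F] [TopologicalSpace E] [IsTopologicalRing F] [IsTopologicalRing E]
  (σ : E →+* E) (ι : F →+* E) (lam : E) (ρ : E → F × F)
  (hρ1 : ∀ z, ι (ρ z).1 + lam * ι (ρ z).2 = z) (hσι : ∀ r, σ (ι r) = ι r) (hσl : σ lam = -lam) (h2 : (2 : E) ≠ 0) (d : F) (hd : lam * lam = ι d)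
  (hl0 : lam ≠ 0)
  [MeasurableSpace ↥(lieOfForm σ !![(0 : E), 1; 1, 0])] [BorelSpace ↥(lieOfForm σ !![(0 : E), 1; 1, 0])]
  [MeasurableSpace (Matrix (Fin 2) (Fin 2) F)] [BorelSpace (Matrix (Fin 2) (Fin 2) F)]
  (Φ : ↥(lieOfForm σ !![(0 : E), 1; 1, 0]) ≃+ Matrix (Fin 2) (Fin 2) F) (hΦc : Continuous Φ) (hΦs : Continuous Φ.symm)
  (hΦ : ∀ X : ↥(lieOfForm σ !![(0 : E), 1; 1, 0]),
    Φ X = !![(ρ (X.1 0 0)).1 + (ρ (X.1 0 0)).2, d * (ρ (X.1 0 1)).2; (ρ (X.1 1 0)).2, (ρ (X.1 0 0)).2 - (ρ (X.1 0 0)).1])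
  (T : (↥(lieOfForm σ !![(0 : E), 1; 1, 0]) → ℂ) → ℂ)

include hρ1 hσι hσl h2 hd hl0 hΦc hΦs hΦ in
/-- **THE REDUCTION (Φ′-c, generic frame).**  Let `T ∈ J(𝒩)(𝔲(σ, J₀))` be additive with clause (iv), `ψ : E → ℂ`, `μ` a measure on `𝔲`, and suppose the `𝔤𝔩₂(F)`-side
Fourier transform `𝓕_F h (Y′) = ∫ ψ(ι tr(Y′X′)) h(X′) dΦ_*μ` preserves `C_c^∞` and `T′ ∘ 𝓕_F` (`T′ f′ = T(f′∘Φ)`) is given by a `Φ_*μ`-locally-integrable `Fn′`, locally constant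
at every `X′` with `disc X′ ≠ 0` and with `ω_F(disc X′)·‖Fn′ X′‖` bounded on compacta.  Then `T ∘ 𝓕_𝔲` is given by the `μ`-locally-integrable `Fn := Fn′ ∘ Φ`, locally constant
at every `X` with `disc X` a unit and with `ω_E(disc X)·‖Fn X‖` bounded on compacta, for any weight `ω_E` with `ω_E(ι y) = ω_F(y)` — the three regularity clauses of (L-B_U)′
(U12 ED. 7 :373) on the nose (★ `transport_lieFourier`, ★ `lieTransport_discr`, change of variables ★ K2E5-p17).
[cite: HarishChandra1999AdmissibleDistributions, Thm. 4.4 p. 11, Thm. 7.5 p. 51] [cite: Folland1995, §2.2 Thm. 2.20] [cite: PlatonovRapinchuk1994, §2.3] -/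
theorem nilpotentFourierRegular_of_transport [T2Space E]
    (hT1 : ∀ f₁ f₂ : ↥(lieOfForm σ !![(0 : E), 1; 1, 0]) → ℂ, IsLocSmooth f₁ → IsLocSmooth f₂ → T (f₁ + f₂) = T f₁ + T f₂)
    (hT4 : ∀ f : ↥(lieOfForm σ !![(0 : E), 1; 1, 0]) → ℂ, IsLocSmooth f → (∀ X ∈ tsupport f, ¬ IsNilpotent X.1) → T f = 0)
    (ψ : E → ℂ) (μ : Measure ↥(lieOfForm σ !![(0 : E), 1; 1, 0]))
    (hFs : ∀ h : Matrix (Fin 2) (Fin 2) F → ℂ, IsLocSmooth h →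
      IsLocSmooth (fun Y' : Matrix (Fin 2) (Fin 2) F => ∫ X', ψ (ι (Matrix.trace (Y' * X'))) * h X' ∂(μ.map Φ)))
    (ωE : E → ℝ) (ωF : F → ℝ) (hω : ∀ y, ωE (ι y) = ωF y)
    (hreg : ∃ Fn' : Matrix (Fin 2) (Fin 2) F → ℂ, LocallyIntegrable Fn' (μ.map Φ) ∧
      (∀ h : Matrix (Fin 2) (Fin 2) F → ℂ, IsLocSmooth h →
        T (fun Y => (fun Y' : Matrix (Fin 2) (Fin 2) F => ∫ X', ψ (ι (Matrix.trace (Y' * X'))) * h X' ∂(μ.map Φ)) (Φ Y)) = ∫ X', h X' * Fn' X' ∂(μ.map Φ)) ∧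
      (∀ X' : Matrix (Fin 2) (Fin 2) F, X'.charpoly.discr ≠ 0 → ∀ᶠ Y' in 𝓝 X', Fn' Y' = Fn' X') ∧
      (∀ C' : Set (Matrix (Fin 2) (Fin 2) F), IsCompact C' → ∃ B : ℝ, ∀ X' ∈ C', ωF X'.charpoly.discr * ‖Fn' X'‖ ≤ B)) :
    ∃ Fn : ↥(lieOfForm σ !![(0 : E), 1; 1, 0]) → ℂ, LocallyIntegrable Fn μ ∧
      (∀ f : ↥(lieOfForm σ !![(0 : E), 1; 1, 0]) → ℂ, IsLocSmooth f → T (lieFourier σ !![(0 : E), 1; 1, 0] ψ μ f) = ∫ X, f X * Fn X ∂μ) ∧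
      (∀ X : ↥(lieOfForm σ !![(0 : E), 1; 1, 0]), IsUnit X.1.charpoly.discr → ∀ᶠ Y in 𝓝 X, Fn Y = Fn X) ∧
      (∀ C : Set ↥(lieOfForm σ !![(0 : E), 1; 1, 0]), IsCompact C → ∃ B : ℝ, ∀ X ∈ C, ωE X.1.charpoly.discr * ‖Fn X‖ ≤ B) := by
  obtain ⟨Fn', hFn'i, hFn'T, hFn'c, hFn'b⟩ := hreg
  let eH : ↥(lieOfForm σ !![(0 : E), 1; 1, 0]) ≃ₜ Matrix (Fin 2) (Fin 2) F :=
    { toEquiv := Φ.toEquiv, continuous_toFun := hΦc, continuous_invFun := hΦs }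
  have he : (eH : ↥(lieOfForm σ !![(0 : E), 1; 1, 0]) → Matrix (Fin 2) (Fin 2) F) = Φ := rfl
  refine ⟨fun X => Fn' (Φ X), ?_, fun f hf => ?_, fun X hX => ?_, fun C hC => ?_⟩
  · -- local integrability through the homeomorphism
    have h := (locallyIntegrable_map_homeomorph eH (f := Fn') (μ := μ)).1 (by rw [he]; exact hFn'i)
    rw [he] at h
    exact h
  · -- the representation: `T(𝓕_𝔲 f) = T′(𝓕_F (f∘Φ⁻¹)) = ∫ (f∘Φ⁻¹)·Fn′ dΦ_*μ = ∫ f·(Fn′∘Φ) dμ`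
    have hfs : IsLocSmooth (fun X' => f (Φ.symm X')) := isLocSmooth_comp_lieTransport_symm σ Φ hΦc hΦs hf
    rw [transport_lieFourier σ ι lam ρ hρ1 hσι hσl h2 d hd hl0 Φ hΦc hΦs hΦ T hT1 hT4 ψ μ f (hFs _ hfs), hFn'T _ hfs,
      ← integral_comp_lieTransport σ Φ hΦc hΦs μ (fun X' => f (Φ.symm X') * Fn' X')]
    simp only [AddEquiv.symm_apply_apply]
  · -- local constancy on the regular semisimple set: `disc X = ι(disc ΦX)`
    have hdisc : (Φ X).charpoly.discr ≠ 0 := by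
      intro h0
      have := lieTransport_discr σ ι lam ρ hρ1 hσι hσl h2 d hd Φ hΦ X
      rw [h0, map_zero] at this
      exact hX.ne_zero this
    exact (hΦc.tendsto X).eventually (hFn'c _ hdisc)
  · -- the weighted bound on compacta
    obtain ⟨B, hB⟩ := hFn'b (Φ '' C) (hC.image hΦc)
    refine ⟨B, fun X hX => ?_⟩
    have := hB (Φ X) ⟨X, hX, rfl⟩
    rwa [← hω, ← lieTransport_discr σ ι lam ρ hρ1 hσι hσl h2 d hd Φ hΦ X] at this

end Regularity

end Summit.HodgeConjecture.HodgeConjecture.Cruxes.H413.K2E3U11NilpotentInvariantTransport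

end
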